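import Summits.ResolutionOfSingularities.ResolutionOfSingularities.Theorems.PurelyInseparableDim4ResConeCInfSharpEntryCorePrime
import HarnessLib
import HarnessLib.Audit.Tags

/-!
# Purely inseparable four-folds — the ♯-frame data ALONG A TRANSLATED SLOT CHAIN, every prime: from a flagless state through a letter
# change to REGIME R + LAYER + ♯-flag at every later time (cell `res-dim4-pi`, K2(p) lane, power-cone light-pair line, flagless branch, FILE ♯8-chain)

[OURS · counted 0 · cell `res-dim4-pi` · K2(p) lane (holder res-dim4-p-12 g5); seat res-dim4-p-3 g6 (MEMO `res-dim4-p-3/MEMO-g6-FLAGLESS-SHARP.md`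
§2–§3, port plan §6 ♯8).]  Nothing here proves K2(p) for any `p`, any TAIL(p, p−1, 3), `NoIsolatedTrap p p`, the Cossart–Jannsen–Saito theorem or
resolution of singularities in dimension ≥ 4 / characteristic `p` — NOT proved.  AI kernel work, weaker than expert review.  Exponent algebra over
the single-step lemmas ♯1/♯2/♯2b/♯3/♯4 and ♯8-core; no chart transport here (that is res-dim4-typ-1 g6's virtual translated chain
`exists_virtual_translated_chain_prime`, whose output is exactly the hypothesis list below).

SETTING.  Letters `j, i` (slots), `u, f` (free), `d + 1 = p`; a finite TRANSLATED SLOT CHAIN `Bs 0, …, Bs T`: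
`Bs (t+1) = step p univ (ℓs t) (update 0 u (βs t)) (Bs t)` (`t < T`), `ℓs t ∈ {j, i}`, every `Bs t` (`t ≤ T`) «in regime» (order `≥ p` along
`univ` and support form: degree `≥ d + 3` or the cone `x_j x_i x_f^d`); `Bs 0` has slot exponents `≥ 1`, the exact ledger
(`e_f ≤ d − 1 ⇒ e_j, e_i ≥ 2`) and NO u-row flag (`coeff x_j²x_i²x_u^{d−1−c}x_f^c = 0`, `c + 2 ≤ d`).
* §1 **`sharpEntry_step_either_prime`** — ♯8-core `sharpEntry_step_prime` for a step in EITHER slot (mirror `j ↔ i` by `gameExp_swap`).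
* §2 **`chain_base_prime`** — slot exponents `≥ 1`, the exact ledger and flaglessness hold at EVERY `t ≤ T` (♯2 `ledger_step_translate_u`,
  ♯1 `coeff_flag_step_translate_u`, both mirrored).
* §3 **`chain_nokill_prime`** — KILLER EXCLUSION: if `ℓs t₀ = j` and a later letter change `ℓs t₁ ≠ ℓs (t₁+1)` (`t₀ < t₁`, `t₁ + 2 ≤ T`) exists,
  then `Bs (t₀+1)` carries NO `j`-killer `x_j^{a}x_i²x_u^{d+1−c−a}x_f^c` (`3 ≤ a`, `c + 2 ≤ d`): a killer forbids every later `j`-step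
  (♯3 `not_regime_step_translate_u_of_killer`) and survives every `i`-step (♯3 `coeff_killer_step_translate_other`), so all later letters
  would be `i` — contradicting the change at `t₁`.  (In the infinite chain the change exists by the free-tail lemma.)
* §4 **`sharp_chain_prime`** — THE CHAIN THEOREM: with a letter change at `t₀` (`ℓs t₀ ≠ ℓs (t₀+1)`) and another at `t₁ > t₀`, `t₁ + 2 ≤ T`:
  at every time `t` with `t₀ + 2 ≤ t`, `t + 1 ≤ T` the state `Bs t` has slot exponents `≥ 1`, the exact ledger, REGIME R
  (`e_f + 2 ≤ d ⇒ e_j, e_i ≥ 3`) and LAYER (no degree-`(d+3)` monomial with `e_f + 2 ≤ d`); and if `d ≤ 6`, `t₀ + 3 ≤ t` and `Bs t` is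
  ISOLATED, its ♯-flag `coeff x_j³x_i³x_u^{d−2}` is non-zero (♯8-core start at `t₀`, §3 for the killer hypothesis, §1 inductively).
  `sharp_chain_prime_of_eq` is the case `ℓs t₀ = j`; the theorem is its `j ↔ i` symmetrisation.
This is the state-level half of ENTRY♯ (E5♯); the chain-level half (Q-flag absent on a light-pair chain ⇒ the ♯-window's entry `hE♯`) composes it
with res-dim4-typ-1 g6's (I♭)/(ℓ-sat)/E4♯.
[cite: Hauser2010, §§F–G] [cite: CossartJannsenSaito2020, Thm. 3.14]
bears_on: LADDER-RESOLUTION:D157-DOOR2 (res-dim4-pi · K2(p) · power cones · flagless branch ♯8-chain).  Supports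
stmt-ResolutionOfSingularities-16155 (helper).
-/

set_option linter.dupNamespace false -- mandated namespace of this single-conjunct summit

noncomputable section

namespace Summit.ResolutionOfSingularities.ResolutionOfSingularities.Theorems.PIDim4

namespace ResCone

open MvPolynomial Finset
open Literature.AlgebraicGeometry.Resolution
open Literature.AlgebraicGeometry.Resolution.CentreBlowup
open Literature.AlgebraicGeometry.Resolution.Hauser2010
open Literature.AlgebraicGeometry.Resolution.HauserPerlega2019

variable {K : Type} [Field K] [DecidableEq K]

section Chain

variable {j i u f : Fin 4} (hji : j ≠ i) (hju : j ≠ u) (hjf : j ≠ f) (hiu : i ≠ u) (hif : i ≠ f) (huf : u ≠ f)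
include hji hju hjf hiu hif huf

/-! ## 1. Propagation through a step in either slot -/

/-- **♯-PROPAGATION, EITHER SLOT** (♯8-core `sharpEntry_step_prime` and its mirror): parent in regime with slot exponents `≥ 1`, the exact
ledger, regime R and LAYER; child `ℓ₀(β)` (`ℓ₀ ∈ {j, i}`) in regime; grandchild `ℓ(β′)` in regime ⇒ the child has slot exponents `≥ 1`, the
exact ledger, regime R, LAYER, and — if `d ≤ 6` and the child is isolated — a non-zero ♯-flag. [OURS] [cite: Hauser2010, §§F–G] -/
theorem sharpEntry_step_either_prime (p : ℕ) [hp : Fact p.Prime] {d : ℕ} (hdp : d + 1 = p) (hd2 : 2 ≤ d) (s : State K)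
    (hq : ((p : ℕ) : ℕ∞) ≤ ordAlong Finset.univ s.F) (hr1 : ∀ e ∈ s.F.support, 1 ≤ e j ∧ 1 ≤ e i)
    (hreg : ∀ E ∈ s.F.support, d + 3 ≤ E.degree ∨ E = Finsupp.single j 1 + Finsupp.single i 1 + Finsupp.single u 0 + Finsupp.single f d)
    (hled : ∀ e ∈ s.F.support, e f ≤ d - 1 → 2 ≤ e j ∧ 2 ≤ e i)
    (hR : ∀ e ∈ s.F.support, e f + 2 ≤ d → 3 ≤ e j ∧ 3 ≤ e i)
    (hlayer : ∀ E : Fin 4 →₀ ℕ, E.degree = d + 3 → E f + 2 ≤ d → coeff E s.F = 0)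
    {ℓ₀ : Fin 4} (hℓ₀ : ℓ₀ = j ∨ ℓ₀ = i) (β : K)
    (hq₁ : ((p : ℕ) : ℕ∞) ≤ ordAlong Finset.univ (CentreBlowup.step p Finset.univ ℓ₀ (Function.update (0 : Fin 4 → K) u β) s).F)
    (hreg₁ : ∀ E ∈ (CentreBlowup.step p Finset.univ ℓ₀ (Function.update (0 : Fin 4 → K) u β) s).F.support,
      d + 3 ≤ E.degree ∨ E = Finsupp.single j 1 + Finsupp.single i 1 + Finsupp.single u 0 + Finsupp.single f d)
    {ℓ : Fin 4} (hℓ : ℓ = j ∨ ℓ = i) (β' : K)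
    (hreg₂ : ∀ E ∈ (CentreBlowup.step p Finset.univ ℓ (Function.update (0 : Fin 4 → K) u β')
        (CentreBlowup.step p Finset.univ ℓ₀ (Function.update (0 : Fin 4 → K) u β) s)).F.support,
      d + 3 ≤ E.degree ∨ E = Finsupp.single j 1 + Finsupp.single i 1 + Finsupp.single u 0 + Finsupp.single f d) :
    (∀ e ∈ (CentreBlowup.step p Finset.univ ℓ₀ (Function.update (0 : Fin 4 → K) u β) s).F.support, 1 ≤ e j ∧ 1 ≤ e i) ∧
      (∀ e ∈ (CentreBlowup.step p Finset.univ ℓ₀ (Function.update (0 : Fin 4 → K) u β) s).F.support,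
        e f ≤ d - 1 → 2 ≤ e j ∧ 2 ≤ e i) ∧
      (∀ e ∈ (CentreBlowup.step p Finset.univ ℓ₀ (Function.update (0 : Fin 4 → K) u β) s).F.support,
        e f + 2 ≤ d → 3 ≤ e j ∧ 3 ≤ e i) ∧
      (∀ E : Fin 4 →₀ ℕ, E.degree = d + 3 → E f + 2 ≤ d →
        coeff E (CentreBlowup.step p Finset.univ ℓ₀ (Function.update (0 : Fin 4 → K) u β) s).F = 0) ∧
      (d ≤ 6 → IsIsolated p (CentreBlowup.step p Finset.univ ℓ₀ (Function.update (0 : Fin 4 → K) u β) s).F →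
        coeff (Finsupp.single j 3 + Finsupp.single i 3 + Finsupp.single u (d - 2) + Finsupp.single f 0)
          (CentreBlowup.step p Finset.univ ℓ₀ (Function.update (0 : Fin 4 → K) u β) s).F ≠ 0) := by
  rcases hℓ₀ with h | h <;> rw [h] at hq₁ hreg₁ hreg₂ ⊢
  · obtain ⟨h1, h2, h3, h4, -, h6⟩ := sharpEntry_step_prime hji hju hjf hiu hif huf p hdp hd2 s hq hr1 hreg hled hR hlayer β hq₁
      hreg₁ hℓ β' hreg₂
    exact ⟨h1, h2, h3, h4, h6⟩
  · have hcone : (Finsupp.single j 1 + Finsupp.single i 1 + Finsupp.single u 0 + Finsupp.single f d : Fin 4 →₀ ℕ) =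
        Finsupp.single i 1 + Finsupp.single j 1 + Finsupp.single u 0 + Finsupp.single f d := gameExp_swap 1 1 0 d
    have hsharp : (Finsupp.single j 3 + Finsupp.single i 3 + Finsupp.single u (d - 2) + Finsupp.single f 0 : Fin 4 →₀ ℕ) =
        Finsupp.single i 3 + Finsupp.single j 3 + Finsupp.single u (d - 2) + Finsupp.single f 0 := gameExp_swap 3 3 (d - 2) 0
    obtain ⟨h1, h2, h3, h4, -, h6⟩ := sharpEntry_step_prime hji.symm hiu hif hju hjf huf p hdp hd2 s hq
      (fun e he => (hr1 e he).symm) (fun E hE => (hreg E hE).imp_right fun h => h.trans hcone)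
      (fun e he hef => (hled e he hef).symm) (fun e he hef => (hR e he hef).symm) hlayer β hq₁
      (fun E hE => (hreg₁ E hE).imp_right fun h => h.trans hcone) hℓ.symm β'
      (fun E hE => (hreg₂ E hE).imp_right fun h => h.trans hcone)
    exact ⟨fun e he => (h1 e he).symm, fun e he hef => (h2 e he hef).symm, fun e he hef => (h3 e he hef).symm, h4,
      fun hd6 hiso => by rw [hsharp]; exact h6 hd6 hiso⟩

/-! ## 2. Base invariants along the chain -/

/-- **BASE INVARIANTS OF A TRANSLATED SLOT CHAIN** (module docstring §2): slot exponents `≥ 1`, the exact ledger and the absence of every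
u-row flag propagate from `Bs 0` to every `Bs t`, `t ≤ T`. [OURS] [cite: Hauser2010, §§F–G] -/
theorem chain_base_prime (p : ℕ) [hp : Fact p.Prime] {d : ℕ} (hdp : d + 1 = p) (hd2 : 2 ≤ d)
    (Bs : ℕ → State K) (ℓs : ℕ → Fin 4) (βs : ℕ → K) {T : ℕ}
    (hstep : ∀ t, t < T → Bs (t + 1) = CentreBlowup.step p Finset.univ (ℓs t) (Function.update (0 : Fin 4 → K) u (βs t)) (Bs t))
    (hℓ : ∀ t, ℓs t = j ∨ ℓs t = i)
    (hq : ∀ t, t ≤ T → ((p : ℕ) : ℕ∞) ≤ ordAlong Finset.univ (Bs t).F)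
    (hreg : ∀ t, t ≤ T → ∀ E ∈ (Bs t).F.support,
      d + 3 ≤ E.degree ∨ E = Finsupp.single j 1 + Finsupp.single i 1 + Finsupp.single u 0 + Finsupp.single f d)
    (hr1₀ : ∀ e ∈ (Bs 0).F.support, 1 ≤ e j ∧ 1 ≤ e i)
    (hled₀ : ∀ e ∈ (Bs 0).F.support, e f ≤ d - 1 → 2 ≤ e j ∧ 2 ≤ e i)
    (hflag₀ : ∀ c, c + 2 ≤ d →
      coeff (Finsupp.single j 2 + Finsupp.single i 2 + Finsupp.single u (d - 1 - c) + Finsupp.single f c) (Bs 0).F = 0) :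
    ∀ t, t ≤ T →
      (∀ e ∈ (Bs t).F.support, 1 ≤ e j ∧ 1 ≤ e i) ∧
        (∀ e ∈ (Bs t).F.support, e f ≤ d - 1 → 2 ≤ e j ∧ 2 ≤ e i) ∧
        (∀ c, c + 2 ≤ d →
          coeff (Finsupp.single j 2 + Finsupp.single i 2 + Finsupp.single u (d - 1 - c) + Finsupp.single f c) (Bs t).F = 0) := by
  intro t
  induction t with
  | zero => exact fun _ => ⟨hr1₀, hled₀, hflag₀⟩
  | succ t ih =>
    intro ht
    obtain ⟨hr1, hled, hflag⟩ := ih (by omega)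
    obtain ⟨h6, hstraight⟩ := h6_straight_of_reg (hreg t (by omega))
    have hqt := hq t (by omega)
    rw [hstep t (by omega)]
    rcases hℓ t with hl | hl <;> rw [hl]
    · refine ⟨fun E hE => ?_, (ledger_step_translate_u hji hju hjf hiu hif huf p hdp hd2 (Bs t) hqt h6 hstraight hled (βs t)).1,
        fun c hc => ?_⟩
      · obtain ⟨δ, hmem, hm, hi, -, -⟩ :=
          exists_parent_of_mem_support_step_translate_u hji hju hjf hiu hif huf p (Bs t) hqt (βs t) hE
        have := h6 δ hmem
        exact ⟨by omega, by rw [← hi]; exact (hr1 δ hmem).2⟩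
      · rw [coeff_flag_step_translate_u hji hju hjf hiu hif huf p hdp hd2 (Bs t) hqt (fun e he hef => (hled e he hef).1) (βs t) hc,
          hflag c hc]
    · have hcone : (Finsupp.single j 1 + Finsupp.single i 1 + Finsupp.single u 0 + Finsupp.single f d : Fin 4 →₀ ℕ) =
          Finsupp.single i 1 + Finsupp.single j 1 + Finsupp.single u 0 + Finsupp.single f d := gameExp_swap 1 1 0 d
      have hstraight' : ∀ e ∈ (Bs t).F.support, e.degree = d + 2 →
          e = Finsupp.single i 1 + Finsupp.single j 1 + Finsupp.single u 0 + Finsupp.single f d := fun e he hd =>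
        (hstraight e he hd).trans hcone
      have hled' : ∀ e ∈ (Bs t).F.support, e f ≤ d - 1 → 2 ≤ e i ∧ 2 ≤ e j := fun e he hef => (hled e he hef).symm
      refine ⟨fun E hE => ?_, fun e he hef =>
        ((ledger_step_translate_u hji.symm hiu hif hju hjf huf p hdp hd2 (Bs t) hqt h6 hstraight' hled' (βs t)).1 e he hef).symm,
        fun c hc => ?_⟩
      · obtain ⟨δ, hmem, hm, hj, -, -⟩ :=
          exists_parent_of_mem_support_step_translate_u hji.symm hiu hif hju hjf huf p (Bs t) hqt (βs t) hE
        have := h6 δ hmem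
        exact ⟨by rw [← hj]; exact (hr1 δ hmem).1, by omega⟩
      · rw [gameExp_swap 2 2 (d - 1 - c) c,
          coeff_flag_step_translate_u hji.symm hiu hif hju hjf huf p hdp hd2 (Bs t) hqt (fun e he hef => (hled e he hef).2) (βs t) hc,
          ← gameExp_swap 2 2 (d - 1 - c) c, hflag c hc]

/-! ## 3. Killer exclusion from a later letter change -/

/-- **NO KILLER BEFORE A LETTER CHANGE** (module docstring §3): in a translated slot chain in regime, if the step at `t₀` is a `j`-step and
some later step changes letter (`ℓs t₁ ≠ ℓs (t₁ + 1)`, `t₀ < t₁`, `t₁ + 2 ≤ T`), then `Bs (t₀ + 1)` has no `j`-killer. [OURS]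
[cite: Hauser2010, §§F–G] -/
theorem chain_nokill_prime (p : ℕ) [hp : Fact p.Prime] {d : ℕ} (hdp : d + 1 = p) (hd2 : 2 ≤ d)
    (Bs : ℕ → State K) (ℓs : ℕ → Fin 4) (βs : ℕ → K) {T : ℕ}
    (hstep : ∀ t, t < T → Bs (t + 1) = CentreBlowup.step p Finset.univ (ℓs t) (Function.update (0 : Fin 4 → K) u (βs t)) (Bs t))
    (hℓ : ∀ t, ℓs t = j ∨ ℓs t = i)
    (hq : ∀ t, t ≤ T → ((p : ℕ) : ℕ∞) ≤ ordAlong Finset.univ (Bs t).F)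
    (hreg : ∀ t, t ≤ T → ∀ E ∈ (Bs t).F.support,
      d + 3 ≤ E.degree ∨ E = Finsupp.single j 1 + Finsupp.single i 1 + Finsupp.single u 0 + Finsupp.single f d)
    (hbase : ∀ t, t ≤ T →
      (∀ e ∈ (Bs t).F.support, e f ≤ d - 1 → 2 ≤ e j ∧ 2 ≤ e i) ∧
        (∀ c, c + 2 ≤ d →
          coeff (Finsupp.single j 2 + Finsupp.single i 2 + Finsupp.single u (d - 1 - c) + Finsupp.single f c) (Bs t).F = 0))
    {t₀ t₁ : ℕ} (h01 : t₀ < t₁) (ht₁ : t₁ + 2 ≤ T) (hch₁ : ℓs t₁ ≠ ℓs (t₁ + 1)) :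
    ∀ a c : ℕ, 3 ≤ a → c + 2 ≤ d → a ≤ d + 1 - c →
      coeff (Finsupp.single j a + Finsupp.single i 2 + Finsupp.single u (d + 1 - c - a) + Finsupp.single f c) (Bs (t₀ + 1)).F = 0 := by
  intro a c ha hc hac
  by_contra hne
  obtain ⟨a', rfl⟩ : ∃ a', a = a' + 1 := ⟨a - 1, by omega⟩
  have hac' : a' ≤ d - c := by omega
  rw [show d + 1 - c - (a' + 1) = d - c - a' by omega] at hne
  -- a killer forbids the next `j`-step …
  have hletter : ∀ t, t + 1 ≤ T →
      coeff (Finsupp.single j (a' + 1) + Finsupp.single i 2 + Finsupp.single u (d - c - a') + Finsupp.single f c) (Bs t).F ≠ 0 →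
        ℓs t = i := by
    intro t ht hk
    rcases hℓ t with hl | hl
    · exfalso
      obtain ⟨hled, hflag⟩ := hbase t (by omega)
      refine not_regime_step_translate_u_of_killer hji hju hjf hiu hif huf p hdp hd2 (Bs t) (hq t (by omega)) hled hac' hc
        (hflag c hc) hk (βs t) ?_
      have h := hreg (t + 1) ht
      rw [hstep t (by omega), hl] at h
      exact h
    · exact hl
  -- … and survives the next `i`-step
  have hpersist : ∀ t, t + 1 ≤ T →
      coeff (Finsupp.single j (a' + 1) + Finsupp.single i 2 + Finsupp.single u (d - c - a') + Finsupp.single f c) (Bs t).F ≠ 0 →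
        coeff (Finsupp.single j (a' + 1) + Finsupp.single i 2 + Finsupp.single u (d - c - a') + Finsupp.single f c)
          (Bs (t + 1)).F ≠ 0 := by
    intro t ht hk
    have hl := hletter t ht hk
    obtain ⟨hled, -⟩ := hbase t (by omega)
    rw [hstep t (by omega), hl, coeff_killer_step_translate_other hji hju hjf hiu hif huf p hdp hd2 (Bs t) (hq t (by omega)) hled
      hac' (by omega) (βs t)]
    exact hk
  have key : ∀ n, t₀ + 1 + n + 1 ≤ T →
      coeff (Finsupp.single j (a' + 1) + Finsupp.single i 2 + Finsupp.single u (d - c - a') + Finsupp.single f c)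
        (Bs (t₀ + 1 + n)).F ≠ 0 := by
    intro n
    induction n with
    | zero => exact fun _ => hne
    | succ n ih => exact fun hT => hpersist (t₀ + 1 + n) (by omega) (ih (by omega))
  have h1 : ℓs t₁ = i := by
    refine hletter t₁ (by omega) ?_
    have h := key (t₁ - (t₀ + 1)) (by omega)
    rwa [show t₀ + 1 + (t₁ - (t₀ + 1)) = t₁ by omega] at h
  have h2 : ℓs (t₁ + 1) = i := by
    refine hletter (t₁ + 1) (by omega) ?_
    have h := key (t₁ + 1 - (t₀ + 1)) (by omega)
    rwa [show t₀ + 1 + (t₁ + 1 - (t₀ + 1)) = t₁ + 1 by omega] at h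
  exact hch₁ (h1.trans h2.symm)

/-! ## 4. The chain theorem -/

/-- **THE ♯-FRAME ALONG A TRANSLATED SLOT CHAIN, change at a `j`-step** (module docstring §4, case `ℓs t₀ = j`). [OURS]
[cite: Hauser2010, §§F–G] [cite: CossartJannsenSaito2020, Thm. 3.14] -/
theorem sharp_chain_prime_of_eq (p : ℕ) [hp : Fact p.Prime] {d : ℕ} (hdp : d + 1 = p) (hd2 : 2 ≤ d)
    (Bs : ℕ → State K) (ℓs : ℕ → Fin 4) (βs : ℕ → K) {T : ℕ}
    (hstep : ∀ t, t < T → Bs (t + 1) = CentreBlowup.step p Finset.univ (ℓs t) (Function.update (0 : Fin 4 → K) u (βs t)) (Bs t))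
    (hℓ : ∀ t, ℓs t = j ∨ ℓs t = i)
    (hq : ∀ t, t ≤ T → ((p : ℕ) : ℕ∞) ≤ ordAlong Finset.univ (Bs t).F)
    (hreg : ∀ t, t ≤ T → ∀ E ∈ (Bs t).F.support,
      d + 3 ≤ E.degree ∨ E = Finsupp.single j 1 + Finsupp.single i 1 + Finsupp.single u 0 + Finsupp.single f d)
    (hr1₀ : ∀ e ∈ (Bs 0).F.support, 1 ≤ e j ∧ 1 ≤ e i)
    (hled₀ : ∀ e ∈ (Bs 0).F.support, e f ≤ d - 1 → 2 ≤ e j ∧ 2 ≤ e i)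
    (hflag₀ : ∀ c, c + 2 ≤ d →
      coeff (Finsupp.single j 2 + Finsupp.single i 2 + Finsupp.single u (d - 1 - c) + Finsupp.single f c) (Bs 0).F = 0)
    {t₀ t₁ : ℕ} (h01 : t₀ < t₁) (ht₁ : t₁ + 2 ≤ T) (hκ : ℓs t₀ = j) (hch₀ : ℓs t₀ ≠ ℓs (t₀ + 1))
    (hch₁ : ℓs t₁ ≠ ℓs (t₁ + 1)) :
    ∀ t, t₀ + 2 ≤ t → t + 1 ≤ T →
      (∀ e ∈ (Bs t).F.support, 1 ≤ e j ∧ 1 ≤ e i) ∧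
        (∀ e ∈ (Bs t).F.support, e f ≤ d - 1 → 2 ≤ e j ∧ 2 ≤ e i) ∧
        (∀ e ∈ (Bs t).F.support, e f + 2 ≤ d → 3 ≤ e j ∧ 3 ≤ e i) ∧
        (∀ E : Fin 4 →₀ ℕ, E.degree = d + 3 → E f + 2 ≤ d → coeff E (Bs t).F = 0) ∧
        (d ≤ 6 → t₀ + 3 ≤ t → IsIsolated p (Bs t).F →
          coeff (Finsupp.single j 3 + Finsupp.single i 3 + Finsupp.single u (d - 2) + Finsupp.single f 0) (Bs t).F ≠ 0) := by
  have hbase := chain_base_prime hji hju hjf hiu hif huf p hdp hd2 Bs ℓs βs hstep hℓ hq hreg hr1₀ hled₀ hflag₀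
  have ho : ℓs (t₀ + 1) = i := by
    rcases hℓ (t₀ + 1) with h | h
    · exact absurd (hκ.trans h.symm) hch₀
    · exact h
  have hnokill := chain_nokill_prime hji hju hjf hiu hif huf p hdp hd2 Bs ℓs βs hstep hℓ hq hreg
    (fun t ht => ⟨(hbase t ht).2.1, (hbase t ht).2.2⟩) h01 ht₁ hch₁
  -- the three steps after `t₀`
  have hS1 : Bs (t₀ + 1) = CentreBlowup.step p Finset.univ j (Function.update (0 : Fin 4 → K) u (βs t₀)) (Bs t₀) := by
    rw [hstep t₀ (by omega), hκ]
  have hS2 : Bs (t₀ + 2) = CentreBlowup.step p Finset.univ i (Function.update (0 : Fin 4 → K) u (βs (t₀ + 1))) (Bs (t₀ + 1)) := by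
    rw [hstep (t₀ + 1) (by omega), ho]
  have hS3 : Bs (t₀ + 3) =
      CentreBlowup.step p Finset.univ (ℓs (t₀ + 2)) (Function.update (0 : Fin 4 → K) u (βs (t₀ + 2))) (Bs (t₀ + 2)) :=
    hstep (t₀ + 2) (by omega)
  obtain ⟨hr1', hled', hflag'⟩ := hbase t₀ (by omega)
  have hstart := sharpEntry_start_prime hji hju hjf hiu hif huf p hdp hd2 (Bs t₀) (hq t₀ (by omega)) hr1' (hreg t₀ (by omega))
    hled' hflag' (βs t₀) (by rw [← hS1]; exact hq (t₀ + 1) (by omega)) (by rw [← hS1]; exact hreg (t₀ + 1) (by omega))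
    (by rw [← hS1]; exact hnokill) (βs (t₀ + 1)) (by rw [← hS1, ← hS2]; exact hq (t₀ + 2) (by omega))
    (by rw [← hS1, ← hS2]; exact hreg (t₀ + 2) (by omega)) (hℓ (t₀ + 2)) (βs (t₀ + 2))
    (by rw [← hS1, ← hS2, ← hS3]; exact hreg (t₀ + 3) (by omega))
  rw [← hS1, ← hS2] at hstart
  -- induction along the chain
  have main : ∀ n, t₀ + 2 + n + 1 ≤ T →
      ((∀ e ∈ (Bs (t₀ + 2 + n)).F.support, 1 ≤ e j ∧ 1 ≤ e i) ∧
        (∀ e ∈ (Bs (t₀ + 2 + n)).F.support, e f ≤ d - 1 → 2 ≤ e j ∧ 2 ≤ e i) ∧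
        (∀ e ∈ (Bs (t₀ + 2 + n)).F.support, e f + 2 ≤ d → 3 ≤ e j ∧ 3 ≤ e i) ∧
        (∀ E : Fin 4 →₀ ℕ, E.degree = d + 3 → E f + 2 ≤ d → coeff E (Bs (t₀ + 2 + n)).F = 0)) ∧
      (d ≤ 6 → 1 ≤ n → IsIsolated p (Bs (t₀ + 2 + n)).F →
        coeff (Finsupp.single j 3 + Finsupp.single i 3 + Finsupp.single u (d - 2) + Finsupp.single f 0) (Bs (t₀ + 2 + n)).F ≠ 0) := by
    intro n
    induction n with
    | zero => exact fun _ => ⟨hstart, fun _ h _ => absurd h (by omega)⟩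
    | succ n ih =>
      intro hT
      obtain ⟨⟨hr1, hled, hR, hlayer⟩, -⟩ := ih (by omega)
      have hc1 : Bs (t₀ + 2 + n + 1) = CentreBlowup.step p Finset.univ (ℓs (t₀ + 2 + n))
          (Function.update (0 : Fin 4 → K) u (βs (t₀ + 2 + n))) (Bs (t₀ + 2 + n)) := hstep (t₀ + 2 + n) (by omega)
      have hc2 : Bs (t₀ + 2 + n + 2) = CentreBlowup.step p Finset.univ (ℓs (t₀ + 2 + n + 1))
          (Function.update (0 : Fin 4 → K) u (βs (t₀ + 2 + n + 1))) (Bs (t₀ + 2 + n + 1)) := hstep (t₀ + 2 + n + 1) (by omega)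
      have H := sharpEntry_step_either_prime hji hju hjf hiu hif huf p hdp hd2 (Bs (t₀ + 2 + n)) (hq (t₀ + 2 + n) (by omega)) hr1
        (hreg (t₀ + 2 + n) (by omega)) hled hR hlayer (hℓ (t₀ + 2 + n)) (βs (t₀ + 2 + n))
        (by rw [← hc1]; exact hq (t₀ + 2 + n + 1) (by omega)) (by rw [← hc1]; exact hreg (t₀ + 2 + n + 1) (by omega))
        (hℓ (t₀ + 2 + n + 1)) (βs (t₀ + 2 + n + 1)) (by rw [← hc1, ← hc2]; exact hreg (t₀ + 2 + n + 2) (by omega))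
      rw [← hc1] at H
      obtain ⟨h1, h2, h3, h4, h5⟩ := H
      exact ⟨⟨h1, h2, h3, h4⟩, fun hd6 _ hiso => h5 hd6 hiso⟩
  intro t ht htT
  obtain ⟨hpk, hg⟩ := main (t - (t₀ + 2)) (by omega)
  rw [show t₀ + 2 + (t - (t₀ + 2)) = t by omega] at hpk hg
  exact ⟨hpk.1, hpk.2.1, hpk.2.2.1, hpk.2.2.2, fun hd6 h3 hiso => hg hd6 (by omega) hiso⟩

/-- **THE ♯-FRAME ALONG A TRANSLATED SLOT CHAIN** (module docstring §4): in a translated slot chain in regime whose initial state has slot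
exponents `≥ 1`, the exact ledger and no u-row flag, with a letter change at `t₀` and another at `t₁ > t₀` (`t₁ + 2 ≤ T`), every state
`Bs t` with `t₀ + 2 ≤ t`, `t + 1 ≤ T` has slot exponents `≥ 1`, the exact ledger, REGIME R and LAYER, and — for `d ≤ 6`, `t₀ + 3 ≤ t` and
`Bs t` isolated — a non-zero ♯-flag `coeff x_j³x_i³x_u^{d−2} ≠ 0`.  The state-level half of ENTRY♯. [OURS] [cite: Hauser2010, §§F–G]
[cite: CossartJannsenSaito2020, Thm. 3.14] -/
theorem sharp_chain_prime (p : ℕ) [hp : Fact p.Prime] {d : ℕ} (hdp : d + 1 = p) (hd2 : 2 ≤ d)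
    (Bs : ℕ → State K) (ℓs : ℕ → Fin 4) (βs : ℕ → K) {T : ℕ}
    (hstep : ∀ t, t < T → Bs (t + 1) = CentreBlowup.step p Finset.univ (ℓs t) (Function.update (0 : Fin 4 → K) u (βs t)) (Bs t))
    (hℓ : ∀ t, ℓs t = j ∨ ℓs t = i)
    (hq : ∀ t, t ≤ T → ((p : ℕ) : ℕ∞) ≤ ordAlong Finset.univ (Bs t).F)
    (hreg : ∀ t, t ≤ T → ∀ E ∈ (Bs t).F.support,
      d + 3 ≤ E.degree ∨ E = Finsupp.single j 1 + Finsupp.single i 1 + Finsupp.single u 0 + Finsupp.single f d)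
    (hr1₀ : ∀ e ∈ (Bs 0).F.support, 1 ≤ e j ∧ 1 ≤ e i)
    (hled₀ : ∀ e ∈ (Bs 0).F.support, e f ≤ d - 1 → 2 ≤ e j ∧ 2 ≤ e i)
    (hflag₀ : ∀ c, c + 2 ≤ d →
      coeff (Finsupp.single j 2 + Finsupp.single i 2 + Finsupp.single u (d - 1 - c) + Finsupp.single f c) (Bs 0).F = 0)
    {t₀ t₁ : ℕ} (h01 : t₀ < t₁) (ht₁ : t₁ + 2 ≤ T) (hch₀ : ℓs t₀ ≠ ℓs (t₀ + 1)) (hch₁ : ℓs t₁ ≠ ℓs (t₁ + 1)) :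
    ∀ t, t₀ + 2 ≤ t → t + 1 ≤ T →
      (∀ e ∈ (Bs t).F.support, 1 ≤ e j ∧ 1 ≤ e i) ∧
        (∀ e ∈ (Bs t).F.support, e f ≤ d - 1 → 2 ≤ e j ∧ 2 ≤ e i) ∧
        (∀ e ∈ (Bs t).F.support, e f + 2 ≤ d → 3 ≤ e j ∧ 3 ≤ e i) ∧
        (∀ E : Fin 4 →₀ ℕ, E.degree = d + 3 → E f + 2 ≤ d → coeff E (Bs t).F = 0) ∧
        (d ≤ 6 → t₀ + 3 ≤ t → IsIsolated p (Bs t).F →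
          coeff (Finsupp.single j 3 + Finsupp.single i 3 + Finsupp.single u (d - 2) + Finsupp.single f 0) (Bs t).F ≠ 0) := by
  rcases hℓ t₀ with hκ | hκ
  · exact sharp_chain_prime_of_eq hji hju hjf hiu hif huf p hdp hd2 Bs ℓs βs hstep hℓ hq hreg hr1₀ hled₀ hflag₀ h01 ht₁ hκ hch₀ hch₁
  · have hcone : (Finsupp.single j 1 + Finsupp.single i 1 + Finsupp.single u 0 + Finsupp.single f d : Fin 4 →₀ ℕ) =
        Finsupp.single i 1 + Finsupp.single j 1 + Finsupp.single u 0 + Finsupp.single f d := gameExp_swap 1 1 0 d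
    have H := sharp_chain_prime_of_eq hji.symm hiu hif hju hjf huf p hdp hd2 Bs ℓs βs hstep (fun t => (hℓ t).symm) hq
      (fun t ht E hE => (hreg t ht E hE).imp_right fun h => h.trans hcone) (fun e he => (hr1₀ e he).symm)
      (fun e he hef => (hled₀ e he hef).symm)
      (fun c hc => by rw [← gameExp_swap 2 2 (d - 1 - c) c]; exact hflag₀ c hc) h01 ht₁ hκ hch₀ hch₁
    intro t ht htT
    obtain ⟨h1, h2, h3, h4, h5⟩ := H t ht htT
    exact ⟨fun e he => (h1 e he).symm, fun e he hef => (h2 e he hef).symm, fun e he hef => (h3 e he hef).symm, h4,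
      fun hd6 h3t hiso => by rw [gameExp_swap 3 3 (d - 2) 0]; exact h5 hd6 h3t hiso⟩

end Chain

end ResCone

end Summit.ResolutionOfSingularities.ResolutionOfSingularities.Theorems.PIDim4
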